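import Summits.HubbardSuperconductivity.HubbardSuperconductivity.Theorems.WeakCouplingBCSKlLindhardEnclosureCeilRules

/-!
# KL-MARGIN-SCAN reader (22) «kernel-lindhard-enclosure» — ceiling soundness RESTRICTED TO THE ROOT SQUARE, part 1/2: the per-leaf predicate and the tree induction

LOCATED (own files, same day): the per-leaf / rule-level ceiling predicates of `…CeilStructural` / `…CeilRules` (`LeafCeilSoundAt`,
`SameSideZeroAt`, `CeilCrudeSoundAt`, `CeilChordSoundAt`, `CeilBdrySoundAt`, `CeilTipSoundAt`) quantify over ALL grid cells `(a, b, c, d)`,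
including cells far outside the root square `[−Xz, Xz]²`, where the kernel's conservative cosine-range tests `mayMinZ/mayMaxZ` are NOT
designed to be sound (they assume abscissae within `±2π`, which admissibility guarantees only inside the root square: `|qᵢ| + Xz ≤ 2·piLoZ`);
so those unrestricted predicates are stronger than what the leaf rules can deliver and are not the right discharge targets.  This file states
the RESTRICTED per-leaf form `LeafCeilSoundIn` — admissible `P`, cell INSIDE THE ROOT SQUARE (`Params.InRoot`) — re-runs the tree
induction with the invariant «the visited cell lies in the root square» (midpoints and guarded cuts stay between the ends), and proves
`ceilSoundAt_of_leafCeilSoundIn : LeafCeilSoundIn P → ∀ t, CeilSoundAt P t`; part 2 (`…CeilRulesInRoot`) states the five restricted RULE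
predicates and closes `CeilSoundAt` from them.  These are the ceiling discharge targets of record; the floor side (`…FloorRules`) needs no
restriction beyond its built-in `inBZ` hypothesis.  Honest framing: reductions only — the five rule predicates are
NOT proved here; floats are floats; nothing in this file asserts a KL margin at any `t′ ≠ 0`, `K₃`, `U₀`, the window or B1g dominance; a
Kohn–Luttinger instability statement is not ODLRO and nothing here proves superconductivity in the Hubbard model.  (p1 g25, 2026-08-29.)
-/

noncomputable section

set_option linter.dupNamespace false

namespace Summit.HubbardSuperconductivity.HubbardSuperconductivity.Theorems.KlLindhardEnclosure

open Real Set MeasureTheory Literature.MathematicalPhysics.QuantumLattice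
open Summit.HubbardSuperconductivity.HubbardSuperconductivity.Theorems

/-! ## §1 Cells inside the root square; the restricted per-leaf predicate and tree induction -/

/-- The grid cell `(a, b, c, d)` lies inside the root square `[−Xz, Xz]²` (all four grid coordinates in `[−Xz, Xz]`). -/
def Params.InRoot (P : Params) (a b c d : ℤ) : Prop :=
  -P.Xz ≤ a ∧ a ≤ P.Xz ∧ -P.Xz ≤ b ∧ b ≤ P.Xz ∧ -P.Xz ≤ c ∧ c ≤ P.Xz ∧ -P.Xz ≤ d ∧ d ≤ P.Xz

/-- Midpoint sub-cells of a cell inside the root square are inside the root square. -/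
theorem Params.InRoot.mid (P : Params) {a b c d : ℤ} (h : P.InRoot a b c d) :
    P.InRoot a ((a + b) / 2) c ((c + d) / 2) ∧ P.InRoot ((a + b) / 2) b c ((c + d) / 2) ∧
    P.InRoot a ((a + b) / 2) ((c + d) / 2) d ∧ P.InRoot ((a + b) / 2) b ((c + d) / 2) d ∧
    P.InRoot a ((a + b) / 2) c d ∧ P.InRoot ((a + b) / 2) b c d ∧
    P.InRoot a b c ((c + d) / 2) ∧ P.InRoot a b ((c + d) / 2) d := by
  unfold Params.InRoot at h ⊢; omega

/-- A guarded x-cut of a cell inside the root square gives sub-cells inside the root square. -/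
theorem Params.InRoot.cutx (P : Params) {a b c d z : ℤ} (h : P.InRoot a b c d) (hz : a < z ∧ z < b) :
    P.InRoot a z c d ∧ P.InRoot z b c d := by
  unfold Params.InRoot at h ⊢; omega

/-- A guarded y-cut of a cell inside the root square gives sub-cells inside the root square. -/
theorem Params.InRoot.cuty (P : Params) {a b c d z : ℤ} (h : P.InRoot a b c d) (hz : c < z ∧ z < d) :
    P.InRoot a b c z ∧ P.InRoot a b z d := by
  unfold Params.InRoot at h ⊢; omega

/-- Admissibility gives `0 ≤ Xz`, so the root cell itself is inside the root square. -/
theorem Params.inRoot_root (P : Params) (hP : P.admissible = true) : P.InRoot (-P.Xz) P.Xz (-P.Xz) P.Xz := by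
  simp only [Params.admissible, Bool.and_eq_true, decide_eq_true_eq] at hP
  have hU : 0 < P.U := hP.1.1.1.1.1.1.2
  have h1 : 3141593 * P.U ≤ P.piUpZ * 1000000 := hP.1.1.1.1.2
  have h2 : P.piUpZ ≤ P.Xz := hP.1.1.2
  unfold Params.InRoot; omega

/-- **RESTRICTED PER-LEAF CEILING SOUNDNESS at `P`** (the discharge target of record): for admissible `P`, every leaf cell INSIDE THE ROOT
SQUARE with `mkX/mkY` corner records and every hint payload, a certified leaf ceiling `some N` is a certified ceiling of the cell
(`CeilValid`: integrability on the cell and `2^30 ∫_cell F ≤ N`). [folklore] -/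
def LeafCeilSoundIn (P : Params) : Prop :=
  ∀ (bd : Option (ℕ × ℕ × ℕ × ℕ)) (tp : Option (ℕ × ℕ × ℕ × ℕ × ℕ × ℕ × ℕ × ℕ)) (a b c d N : ℤ),
    P.admissible = true → P.InRoot a b c d →
      (P.leaf bd tp (P.mkX a) (P.mkX b) (P.mkY c) (P.mkY d)).2 = some N → P.CeilValid a b c d N

/-- **TREE INDUCTION INSIDE THE ROOT SQUARE**: under the restricted per-leaf predicate, a certified ceiling of ANY tree on ANY cell inside the
root square is a certified ceiling of that cell. -/
theorem eval_snd_sound_in (P : Params) (hP : P.admissible = true) (hleaf : LeafCeilSoundIn P) (t : QB) :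
    ∀ a b c d N : ℤ, P.InRoot a b c d → (t.eval P (P.mkX a) (P.mkX b) (P.mkY c) (P.mkY d)).2 = some N →
      P.CeilValid a b c d N := by
  have hU : 0 < P.U := P.U_pos_of_admissible hP
  induction t with
  | o => intro a b c d N hin h; exact hleaf none none a b c d N hP hin (by simpa [QB.eval] using h)
  | d σx σy τx τy =>
      intro a b c d N hin h; exact hleaf (some (σx, σy, τx, τy)) none a b c d N hP hin (by simpa [QB.eval] using h)
  | w a1 a2 a3 a4 a5 a6 a7 a8 =>
      intro a b c d N hin h
      exact hleaf none (some (a1, a2, a3, a4, a5, a6, a7, a8)) a b c d N hP hin (by simpa [QB.eval] using h)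
  | n c00 c10 c01 c11 ih00 ih10 ih01 ih11 =>
      intro a b c d N hin h
      simp only [QB.eval, Params.mkX_z, Params.mkY_z] at h
      obtain ⟨Nl, Nr, hl, hr, hN⟩ := addO_eq_some h
      obtain ⟨N00, N10, h00, h10, hNl⟩ := addO_eq_some hl
      obtain ⟨N01, N11, h01, h11, hNr⟩ := addO_eq_some hr
      obtain ⟨k00, k10, k01, k11, -, -, -, -⟩ := Params.InRoot.mid P hin
      obtain ⟨i00, b00⟩ := ih00 a ((a + b) / 2) c ((c + d) / 2) N00 k00 h00
      obtain ⟨i10, b10⟩ := ih10 ((a + b) / 2) b c ((c + d) / 2) N10 k10 h10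
      obtain ⟨i01, b01⟩ := ih01 a ((a + b) / 2) ((c + d) / 2) d N01 k01 h01
      obtain ⟨i11, b11⟩ := ih11 ((a + b) / 2) b ((c + d) / 2) d N11 k11 h11
      obtain ⟨iL, eL⟩ := P.cellInt_merge_x hU (midpoint_between a b) c ((c + d) / 2) i00 i10
      obtain ⟨iU, eU⟩ := P.cellInt_merge_x hU (midpoint_between a b) ((c + d) / 2) d i01 i11
      obtain ⟨iT, eT⟩ := P.cellInt_merge_y hU a b (midpoint_between c d) iL iU
      refine ⟨iT, ?_⟩
      rw [eT, eL, eU, hN, hNl, hNr]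
      push_cast
      linarith
  | cx z l r ihl ihr =>
      intro a b c d N hin h
      simp only [QB.eval, Params.mkX_z] at h
      split_ifs at h with hz
      · obtain ⟨Nl, Nr, hl, hr, hN⟩ := addO_eq_some h
        obtain ⟨kl, kr⟩ := Params.InRoot.cutx P hin hz
        obtain ⟨il, bl⟩ := ihl a z c d Nl kl hl
        obtain ⟨ir, br⟩ := ihr z b c d Nr kr hr
        obtain ⟨iT, eT⟩ := P.cellInt_merge_x hU (Or.inl ⟨hz.1.le, hz.2.le⟩) c d il ir
        refine ⟨iT, ?_⟩
        rw [eT, hN]; push_cast; linarith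
  | cy z l r ihl ihr =>
      intro a b c d N hin h
      simp only [QB.eval, Params.mkY_z] at h
      split_ifs at h with hz
      · obtain ⟨Nl, Nr, hl, hr, hN⟩ := addO_eq_some h
        obtain ⟨kl, kr⟩ := Params.InRoot.cuty P hin hz
        obtain ⟨il, bl⟩ := ihl a b c z Nl kl hl
        obtain ⟨ir, br⟩ := ihr a b z d Nr kr hr
        obtain ⟨iT, eT⟩ := P.cellInt_merge_y hU a b (Or.inl ⟨hz.1.le, hz.2.le⟩) il ir
        refine ⟨iT, ?_⟩
        rw [eT, hN]; push_cast; linarith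
  | bx l r ihl ihr =>
      intro a b c d N hin h
      simp only [QB.eval, Params.mkX_z] at h
      obtain ⟨Nl, Nr, hl, hr, hN⟩ := addO_eq_some h
      obtain ⟨-, -, -, -, kl, kr, -, -⟩ := Params.InRoot.mid P hin
      obtain ⟨il, bl⟩ := ihl a ((a + b) / 2) c d Nl kl hl
      obtain ⟨ir, br⟩ := ihr ((a + b) / 2) b c d Nr kr hr
      obtain ⟨iT, eT⟩ := P.cellInt_merge_x hU (midpoint_between a b) c d il ir
      refine ⟨iT, ?_⟩
      rw [eT, hN]; push_cast; linarith
  | bY l r ihl ihr =>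
      intro a b c d N hin h
      simp only [QB.eval, Params.mkY_z] at h
      obtain ⟨Nl, Nr, hl, hr, hN⟩ := addO_eq_some h
      obtain ⟨-, -, -, -, -, -, kl, kr⟩ := Params.InRoot.mid P hin
      obtain ⟨il, bl⟩ := ihl a b c ((c + d) / 2) Nl kl hl
      obtain ⟨ir, br⟩ := ihr a b ((c + d) / 2) d Nr kr hr
      obtain ⟨iT, eT⟩ := P.cellInt_merge_y hU a b (midpoint_between c d) il ir
      refine ⟨iT, ?_⟩
      rw [eT, hN]; push_cast; linarith

/-- **STRUCTURAL CEILING SOUNDNESS (restricted per-leaf form)**: `LeafCeilSoundIn P → ∀ t, CeilSoundAt P t`. -/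
theorem ceilSoundAt_of_leafCeilSoundIn (P : Params) (hleaf : LeafCeilSoundIn P) (t : QB) : CeilSoundAt P t := by
  intro N hP hN
  obtain ⟨hint, hle⟩ := eval_snd_sound_in P hP hleaf t (-P.Xz) P.Xz (-P.Xz) P.Xz N (P.inRoot_root hP) hN
  have hsub := P.brillouinZone_subset_rootCell hP
  refine ⟨hint.mono_set hsub, ?_⟩
  have hmono : (∫ p in brillouinZone, P.integrand p) ≤ P.cellInt (-P.Xz) P.Xz (-P.Xz) P.Xz :=
    setIntegral_mono_set hint (Filter.Eventually.of_forall fun p => P.integrand_nonneg p) (Filter.Eventually.of_forall hsub)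
  linarith

end Summit.HubbardSuperconductivity.HubbardSuperconductivity.Theorems.KlLindhardEnclosure

end
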